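import Summits.Ventures.Crystal3D.Theorems.StickyWulffConstantNoReconstructionGainExactLevel
import Summits.Ventures.Crystal3D.Theorems.StickyWulffConstantNoReconstructionGainCellFluxIsolated
import Summits.Ventures.Crystal3D.Theorems.StickyWulffConstantTextureLiminfTexShadowSampleDeficitUpperUnif
import HarnessLib

/-!
# The lattice bonds of the slab sample crossing an interior level; EXACT₀ ⟹ the crux's inequality off an
# off-lattice-free level (line `replication-exactness`, toward UNWRAP)

HONEST FRAMING. Part of the venture `Summits/Ventures/Crystal3D` (cell `crystal3d-full`), supports the
crux `NoReconstructionGain` (stmt-Ventures-19144, route `route-Ventures-StickyWulffConstant`), line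
`replication-exactness` (lead wulff-p1 g17).  Continues `…ExactLevel` (the LEVEL SANDWICH):

* `convex_windowRegion` — the window region `{a ≤ ⟪p,ν⟫ ≤ b, ‖p‖² − ⟪p,ν⟫² ≤ ρ²}` is convex;
* `latticeBody_deficit_le_unif` — the clamped lattice slab's deficiency is `≤ 2φ(ν)πρ² + C(1+T)ρ` with ONE
  constant for all normals, windows and thicknesses `T ≥ 1` (`affineSampleDeficit_upper_unif` in
  `ν`-coordinates);
* `sample_latticeCross_ge` — **the lattice bonds of the slab sample `P_ρ(ν,R)` crossing any interior
  level `t₀ ∈ [−2R+1, −R−2]` number at least `2φ(ν)πρ² − Cρ`**: `cross = D(P_≤) + D(P_>) − D(P)`, the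
  two parts contain the unit windows at the bottom / top of the sample whose deficiencies are
  `≥ 2φπρ² − C₁ρ` (`sampleDeficit_offset_window` at thickness `1`, monotone to the parts by
  `contactDeficiency_le_of_convex_sample`), and `D(P) ≤ 2φπρ² + C₂ρ`;
* `deficit_ge_of_exactZeroGain_of_level` — **EXACT₀ ⟹ `D(X) ≥ 2φ(ν)πρ² − Cρ` for EVERY unit packing
  `X ⊇ P_ρ(ν,R)` admitting an interior level `t₀ ∈ [−2R+1, −R−2]` from which every off-lattice ball of
  `X` keeps height-distance `≥ 1`** (no core reduction, no compatible/wrapped split);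
* `deficit_ge_of_exactZeroGain_of_few_offLattice` — by pigeonhole over `⌊(R−3)/2⌋` disjoint levels:
  the same conclusion for every packing with fewer than `⌊(R−3)/2⌋` off-lattice balls of height in
  `(−2R, −R−1)` (these lie outside the disc: the WRAPPED off-lattice balls).  This contains the compatible
  sector and every packing whose lateral continuation of the slab is on-lattice.

WHAT THIS IS NOT: packings with many off-lattice wrapped balls (the residual, a CONFINEMENT statement for
cores) are not treated; rung F-C1 not moved.
-/

noncomputable section

namespace Summit.Ventures.Crystal3D.Theorems

open Summit.Ventures.Crystal3D
open Literature.MathematicalPhysics.StatisticalMechanics (fccStacking isHaggSeq_const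
  le_dist_of_mem_barlowStacking_ideal contactDeficiency orderedContacts)
open scoped InnerProductSpace
open Finset

/-! ## Convexity of window regions -/

/-- The window region `{a ≤ ⟪p,ν⟫ ≤ b, ‖p‖² − ⟪p,ν⟫² ≤ ρ²}` is convex (`‖ν‖ = 1`, `ρ ≥ 0`). -/
theorem convex_windowRegion (ν : EuclideanSpace ℝ (Fin 3)) (hν : ‖ν‖ = 1) (a b ρ : ℝ) (hρ : 0 ≤ ρ) :
    Convex ℝ {p : EuclideanSpace ℝ (Fin 3) | a ≤ ⟪p, ν⟫_ℝ ∧ ⟪p, ν⟫_ℝ ≤ b ∧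
      ‖p‖ ^ 2 - ⟪p, ν⟫_ℝ ^ 2 ≤ ρ ^ 2} := by
  -- intersect the convex slab-sample region of `…LatticeAdhesion` (for the lateral part) with two
  -- half-spaces
  have h0 := convex_slabSampleRegion ν hν 0 ρ hρ
  have h1 : Convex ℝ {p : EuclideanSpace ℝ (Fin 3) | a ≤ ⟪p, ν⟫_ℝ} := by
    have : {p : EuclideanSpace ℝ (Fin 3) | a ≤ ⟪p, ν⟫_ℝ} = {p | a ≤ (innerSL ℝ ν) p} := by
      ext p; simp [real_inner_comm]
    rw [this]; exact convex_halfSpace_ge (innerSL ℝ ν).isLinear a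
  have h2 : Convex ℝ {p : EuclideanSpace ℝ (Fin 3) | ⟪p, ν⟫_ℝ ≤ b} := by
    have : {p : EuclideanSpace ℝ (Fin 3) | ⟪p, ν⟫_ℝ ≤ b} = {p | (innerSL ℝ ν) p ≤ b} := by
      ext p; simp [real_inner_comm]
    rw [this]; exact convex_halfSpace_le (innerSL ℝ ν).isLinear b
  have hlat : Convex ℝ {p : EuclideanSpace ℝ (Fin 3) | ‖p‖ ^ 2 - ⟪p, ν⟫_ℝ ^ 2 ≤ ρ ^ 2} := by
    -- the lateral condition alone: points of the `R = 0` slab region shifted along `ν` — easier: it is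
    -- the preimage-free description `‖p − ⟪p,ν⟫ν‖ ≤ ρ`, a convex function sublevel set
    have hrepr : {p : EuclideanSpace ℝ (Fin 3) | ‖p‖ ^ 2 - ⟪p, ν⟫_ℝ ^ 2 ≤ ρ ^ 2} =
        {p | ‖p - ⟪p, ν⟫_ℝ • ν‖ ≤ ρ} := by
      ext p
      simp only [Set.mem_setOf_eq]
      have hsq : ‖p - ⟪p, ν⟫_ℝ • ν‖ ^ 2 = ‖p‖ ^ 2 - ⟪p, ν⟫_ℝ ^ 2 := by
        rw [norm_sub_sq_real, norm_smul, inner_smul_right, Real.norm_eq_abs, hν, mul_one, sq_abs]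
        ring
      rw [← hsq]
      constructor
      · intro h; nlinarith [norm_nonneg (p - ⟪p, ν⟫_ℝ • ν)]
      · intro h; nlinarith [norm_nonneg (p - ⟪p, ν⟫_ℝ • ν)]
    rw [hrepr]
    -- `p ↦ p − ⟪p,ν⟫ν` is linear, the norm is convex
    set f : EuclideanSpace ℝ (Fin 3) →ₗ[ℝ] EuclideanSpace ℝ (Fin 3) :=
      LinearMap.id - (LinearMap.toSpanSingleton ℝ _ ν).comp (innerSL ℝ ν).toLinearMap with hf
    have hfp : ∀ p, f p = p - ⟪p, ν⟫_ℝ • ν := by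
      intro p
      simp [hf, LinearMap.toSpanSingleton_apply, real_inner_comm]
    have : {p : EuclideanSpace ℝ (Fin 3) | ‖p - ⟪p, ν⟫_ℝ • ν‖ ≤ ρ} = f ⁻¹' Metric.closedBall 0 ρ := by
      ext p; simp [hfp]
    rw [this]
    exact (convex_closedBall 0 ρ).linear_preimage f
  have := (h1.inter h2).inter hlat
  convert this using 1
  ext p; simp only [Set.mem_setOf_eq, Set.mem_inter_iff]; tauto

/-! ## The body's deficiency from above, uniformly -/

/-- **The clamped lattice slab in `ν`-coordinates: `D ≤ 2φ(ν)πρ² + C(1+T)ρ`** with one constant for all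
normals, windows `[a, b]` of thickness `T = b − a ≥ 1`, and radii `ρ ≥ T`. -/
theorem latticeBody_deficit_le_unif : ∃ C : ℝ, ∀ ν : EuclideanSpace ℝ (Fin 3), ‖ν‖ = 1 →
    ∀ T : ℝ, 1 ≤ T → ∀ a b : ℝ, b - a = T → ∀ ρ : ℝ, T ≤ ρ →
      ∀ L : Finset (EuclideanSpace ℝ (Fin 3)),
        (∀ z, z ∈ L ↔ (z ∈ fccStacking 1 (Real.sqrt (2 / 3)) ∧ a ≤ ⟪z, ν⟫_ℝ ∧ ⟪z, ν⟫_ℝ ≤ b ∧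
          ‖z‖ ^ 2 - ⟪z, ν⟫_ℝ ^ 2 ≤ ρ ^ 2)) →
        contactDeficiency L ≤
          2 * (Real.sqrt 2 / 4 * ∑ᶠ w ∈ {w ∈ fccStacking 1 (Real.sqrt (2 / 3)) | ‖w‖ = 1},
            |⟪w, ν⟫_ℝ|) * Real.pi * ρ ^ 2 + C * (1 + T) * ρ := by
  classical
  obtain ⟨C, hC⟩ := affineSampleDeficit_upper_unif
  refine ⟨C, fun ν hν T hT a b hab ρ hρ L hL => ?_⟩
  obtain ⟨g, hg⟩ := exists_linearIsometryEquiv_apply_eq_single_two ν hν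
  have hgs : g.symm (EuclideanSpace.single (2 : Fin 3) (1 : ℝ)) = ν := by
    rw [← hg, LinearIsometryEquiv.symm_apply_apply]
  have h := hC g 0 T hT a b hab ρ hρ (L.image g) ?_
  · rw [contactDeficiency_image_of_isometry g.isometry, hgs] at h
    exact h
  · intro p
    rw [Finset.mem_image]
    have hp2 : ∀ z : EuclideanSpace ℝ (Fin 3), g z 2 = ⟪z, ν⟫_ℝ := by
      intro z
      have : g z 2 = ⟪g z, EuclideanSpace.single (2 : Fin 3) (1 : ℝ)⟫_ℝ := by
        rw [EuclideanSpace.inner_single_right]; simp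
      rw [this, ← hg, LinearIsometryEquiv.inner_map_map]
    have hp01 : ∀ z : EuclideanSpace ℝ (Fin 3), g z 0 ^ 2 + g z 1 ^ 2 = ‖z‖ ^ 2 - ⟪z, ν⟫_ℝ ^ 2 := by
      intro z
      rw [sq_add_sq_eq_norm_sq_sub, ← hp2 z, LinearIsometryEquiv.norm_map]
      congr 1
      rw [EuclideanSpace.inner_single_right]; simp
    constructor
    · rintro ⟨z, hz, rfl⟩
      obtain ⟨hzΛ, h1, h2, h3⟩ := (hL z).1 hz
      refine ⟨⟨z, hzΛ, by simp⟩, ?_, ?_, ?_⟩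
      · rw [hp2]; exact h1
      · rw [hp2]; exact h2
      · rw [hp01]; exact h3
    · rintro ⟨⟨z, hzΛ, hzp⟩, h1, h2, h3⟩
      simp only [add_zero] at hzp
      subst hzp
      rw [hp2] at h1 h2
      rw [hp01] at h3
      exact ⟨z, (hL z).2 ⟨hzΛ, h1, h2, h3⟩, rfl⟩

/-! ## The lattice bonds of the sample crossing an interior level -/

/-- **Lattice bonds of the slab sample across an interior level.**  For `R ≥ 3` there is `C` such that
for every unit `ν`, every `ρ ≥ R`, every level `t₀ ∈ [−2R+1, −R−2]` and the slab sample
`P = Λ₀ ∩ {−2R ≤ ⟪p,ν⟫ ≤ −R, ‖p‖² − ⟪p,ν⟫² ≤ ρ²}`, the ordered pairs `(x, y) ∈ P × P` with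
`dist x y = 1`, `⟪x,ν⟫ ≤ t₀ < ⟪y,ν⟫` number at least `2φ(ν)πρ² − Cρ`. -/
theorem sample_latticeCross_ge (R : ℝ) (hR : 3 ≤ R) : ∃ C : ℝ, ∀ ν : EuclideanSpace ℝ (Fin 3), ‖ν‖ = 1 →
    ∀ ρ : ℝ, R ≤ ρ → ∀ t₀ : ℝ, -(2 * R) + 1 ≤ t₀ → t₀ ≤ -R - 2 →
      ∀ P : Finset (EuclideanSpace ℝ (Fin 3)),
        (∀ p, p ∈ P ↔ (p ∈ fccStacking 1 (Real.sqrt (2 / 3)) ∧ -(2 * R) ≤ ⟪p, ν⟫_ℝ ∧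
          ⟪p, ν⟫_ℝ ≤ -R ∧ ‖p‖ ^ 2 - ⟪p, ν⟫_ℝ ^ 2 ≤ ρ ^ 2)) →
        2 * (Real.sqrt 2 / 4 * ∑ᶠ w ∈ {w ∈ fccStacking 1 (Real.sqrt (2 / 3)) | ‖w‖ = 1},
            |⟪w, ν⟫_ℝ|) * Real.pi * ρ ^ 2 - C * ρ ≤
          ((((P.filter fun x => ⟪x, ν⟫_ℝ ≤ t₀) ×ˢ (P.filter fun y => ¬ ⟪y, ν⟫_ℝ ≤ t₀)).filter
              fun pq => dist pq.1 pq.2 = 1).card : ℕ) := by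
  classical
  obtain ⟨C₁, hC₁⟩ := sampleDeficit_offset_window 1 le_rfl
  obtain ⟨C₂, hC₂⟩ := latticeBody_deficit_le_unif
  refine ⟨2 * C₁ + C₂ * (1 + R), ?_⟩
  intro ν hν ρ hρ t₀ ht₀lo ht₀hi P hP
  have hρ1 : 1 ≤ ρ := by linarith
  have hρ0 : 0 ≤ ρ := by linarith
  set Plo := P.filter fun x => ⟪x, ν⟫_ℝ ≤ t₀ with hPlo
  set Phi := P.filter fun y => ¬ ⟪y, ν⟫_ℝ ≤ t₀ with hPhi
  have hPΛ : ∀ p ∈ P, p ∈ fccStacking 1 (Real.sqrt (2 / 3)) := fun p hp => ((hP p).1 hp).1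
  -- the split
  have hsplit := contactDeficiency_sdiff_split (X := P) (P := Plo) (Finset.filter_subset _ _)
  rw [show P \ Plo = Phi by rw [hPlo, hPhi, Finset.filter_not]] at hsplit
  -- the bottom unit window inside `Plo`
  set Wb := P.filter fun x => ⟪x, ν⟫_ℝ ≤ -(2 * R) + 1 with hWb
  have hWb_mem : ∀ p, p ∈ Wb ↔ (p ∈ fccStacking 1 (Real.sqrt (2 / 3)) ∧ -(2 * R) ≤ ⟪p + 0, ν⟫_ℝ ∧
      ⟪p + 0, ν⟫_ℝ ≤ -(2 * R) + 1 ∧ ‖p + 0‖ ^ 2 - ⟪p + 0, ν⟫_ℝ ^ 2 ≤ ρ ^ 2) := by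
    intro p
    rw [hWb, Finset.mem_filter, hP, add_zero]
    constructor
    · rintro ⟨⟨h1, h2, -, h4⟩, h5⟩; exact ⟨h1, h2, h5, h4⟩
    · rintro ⟨h1, h2, h3, h4⟩; exact ⟨⟨h1, h2, by linarith, h4⟩, h3⟩
  have hDWb := hC₁ ν hν 0 (-(2 * R)) ρ hρ1 Wb hWb_mem
  have hWbPlo : Wb ⊆ Plo := by
    intro p hp
    rw [hWb, Finset.mem_filter] at hp
    rw [hPlo, Finset.mem_filter]
    exact ⟨hp.1, by linarith [hp.2]⟩
  have hmonb : contactDeficiency Wb ≤ contactDeficiency Plo :=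
    contactDeficiency_le_of_convex_sample Plo Wb _ (convex_windowRegion ν hν (-(2 * R)) (-(2 * R) + 1) ρ hρ0)
      (fun p hp => hPΛ p (Finset.mem_filter.1 (Finset.mem_coe.1 hp)).1) hWbPlo (fun p => by
        rw [hWb, Finset.mem_filter, hP, Set.mem_setOf_eq]
        constructor
        · rintro ⟨⟨h1, h2, -, h4⟩, h5⟩; exact ⟨h1, h2, h5, h4⟩
        · rintro ⟨h1, h2, h3, h4⟩; exact ⟨⟨h1, h2, by linarith, h4⟩, h3⟩)
  -- the top unit window inside `Phi`
  set Wt := P.filter fun x => -R - 1 ≤ ⟪x, ν⟫_ℝ with hWt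
  have hWt_mem : ∀ p, p ∈ Wt ↔ (p ∈ fccStacking 1 (Real.sqrt (2 / 3)) ∧ -R - 1 ≤ ⟪p + 0, ν⟫_ℝ ∧
      ⟪p + 0, ν⟫_ℝ ≤ -R - 1 + 1 ∧ ‖p + 0‖ ^ 2 - ⟪p + 0, ν⟫_ℝ ^ 2 ≤ ρ ^ 2) := by
    intro p
    rw [hWt, Finset.mem_filter, hP, add_zero]
    constructor
    · rintro ⟨⟨h1, -, h3, h4⟩, h5⟩; exact ⟨h1, h5, by linarith, h4⟩
    · rintro ⟨h1, h2, h3, h4⟩; exact ⟨⟨h1, by linarith, by linarith, h4⟩, h2⟩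
  have hDWt := hC₁ ν hν 0 (-R - 1) ρ hρ1 Wt hWt_mem
  have hWtPhi : Wt ⊆ Phi := by
    intro p hp
    rw [hWt, Finset.mem_filter] at hp
    rw [hPhi, Finset.mem_filter, not_le]
    exact ⟨hp.1, by linarith [hp.2]⟩
  have hmont : contactDeficiency Wt ≤ contactDeficiency Phi :=
    contactDeficiency_le_of_convex_sample Phi Wt _ (convex_windowRegion ν hν (-R - 1) (-R) ρ hρ0)
      (fun p hp => hPΛ p (Finset.mem_filter.1 (Finset.mem_coe.1 hp)).1) hWtPhi (fun p => by
        rw [hWt, Finset.mem_filter, hP, Set.mem_setOf_eq]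
        constructor
        · rintro ⟨⟨h1, -, h3, h4⟩, h5⟩; exact ⟨h1, h5, h3, h4⟩
        · rintro ⟨h1, h2, h3, h4⟩; exact ⟨⟨h1, by linarith, h3, h4⟩, h2⟩)
  -- the whole sample from above
  have hDP := hC₂ ν hν R (by linarith) (-(2 * R)) (-R) (by ring) ρ hρ P hP
  -- assemble
  nlinarith [hsplit, hDWb, hDWt, hmonb, hmont, hDP, hρ0, sq_nonneg ρ]

end Summit.Ventures.Crystal3D.Theorems

end
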